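/-
Copyright (c) 2026 the pub-hodgecm-mathlib formalisation cell (harness21).  Prover seat hodgecm-mathlib-K2Liu-p13 (g4), Track B «K2-LIT»,
#184♮ = hLiu418 = `stmt-HodgeConjecture-24832`; ROAD Φ (RULING «M-156n»), #41 TOP edition 5 «ASSEMBLED» — the KIND-0 big-cell continuation letter at a POINT
`κ ∈ K` (after ★∕📤 `K2LiuBigCellContinuationReduction.exists_finset_reduction`): the CURRENCY BRIDGE from the finite-place organ A7-AllS0
(`IsQRationalRegularAt q_v s₀`, pointwise on `{0 < re}`) to the TOP (`DifferentiableOn ℂ · {0 < re}`), and the hypothesis-first POINT ASSEMBLY of its faces.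
THEOREMS ONLY (no `def`, no `instance`, no named-fact hypothesis, no `sorry`).
-/
import Summits.HodgeConjecture.HodgeConjecture.Theorems.K2LiuQRationalDefs     -- ★ `qVar`, `IsQRational`, `IsQRationalRegularAt`
import Mathlib.Analysis.SpecialFunctions.Pow.Deriv
import Mathlib.Analysis.Calculus.Deriv.Polynomial
import HarnessLib

/-!
# Crux `HLiu418`, ROAD Φ, organ Φ8 (row G6): THE BIG-CELL CONTINUATION AT A POINT — `IsQRationalRegularAt ⇒ DifferentiableAt`, and the point assembly

Cell `hodgecm-mathlib`, crux item hLiu418 = `stmt-HodgeConjecture-24832` (helper lane, count-neutral).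
After ★∕📤 `K2LiuBigCellContinuationReduction.exists_finset_reduction` the #41 TOP's kind-0 letter `(E, hEd, hEeq)` is: for finitely many `κ ∈ K`,
`∃ Eκ` holomorphic on `{0 < re}` with `Eκ s = a(s)·M(s)f_s(κ)` on `re s > n∕2`.  Its finite-place face is ★ A7-AllS0
(`K2LiuA7NormalisedRegularityCMAllS0.normalisedRegularity_cm_allS0`: `M_v(s)(f s) h = aNorm_v(s) · Fn s h` on `1 < re s` with
`∀ s₀, 0 < re s₀ → IsQRationalRegularAt q_v s₀ (Fn · h)`), whose currency is POINTWISE `q`-RATIONAL REGULARITY, not holomorphy.  This file: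
* §1 **`differentiableAt_of_isQRationalRegularAt`** — a function that is a rational function of `q^{−s}` regular at `s₀` (`q ≠ 0`) is complex-differentiable AT `s₀`:
  the admissible denominator `Q(q^{−s})` does not vanish on an open neighbourhood of `s₀`, on which `φ = (P∕Q)(q^{−s})`; hence
  **`differentiableOn_of_forall_isQRationalRegularAt`**: `(∀ s₀ ∈ U, IsQRationalRegularAt q s₀ φ) → DifferentiableOn ℂ φ U` — the bridge A7-AllS0 → TOP.
* §2 **`exists_pointContinuation_of_faces`** — the POINT ASSEMBLY, hypothesis-first over an abstract finite index of bad finite places: if on the convergence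
  half-plane `c₀ < re s` the normalised big cell at `κ` factorises as `B s = A s · ∏_{v∈TF} (c_v s · N_v s)` with the archimedean block `A` and the explicit local
  scalars `c_v` holomorphic on `{0 < re}` and every `N_v` `q_v`-rational regular at every `s₀` with `0 < re s₀` (A7-AllS0's clause verbatim), then `B` continues:
  `∃ Eκ` holomorphic on `{0 < re}`, `Eκ = B` on `c₀ < re s`.  (`Eκ := A · ∏ (c_v · N_v)` itself.)  Variant `…_of_faces'` with the `N_v` already holomorphic.
The Euler-face identity `hB` is BY VALUE (★ Φ3c∕Φ3d `whittakerDelta_eq_mul_tprod` at index `0` + Gindikin–Karpelevich off `T` + the `S_ε → T` scalar bookkeeping + the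
pure-tensor split of the `T`-block); `A`'s holomorphy is the archimedean ladder (σ20).
Sources: [KudlaSweet1997, §1 (rationality in `q^{−s}` of `M_v(s)` on standard sections)]; [Casselman1980, §3 Thm. 3.1]; [Tan1999, §3]; [HarrisKudlaSweet1996, §6 (6.14)–(6.16)].
HONEST LABEL.  Helper lemmas, count-neutral; `HC_CM` is proved only modulo the 7 printed citations (2 remaining named inputs:
hLiu418 = `stmt-HodgeConjecture-24832`, h413 = `stmt-HodgeConjecture-24833`) until rung 0 closes.
-/

set_option autoImplicit false
set_option linter.dupNamespace false -- the mandated namespace repeats `HodgeConjecture.HodgeConjecture`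

noncomputable section

open Polynomial Filter Topology

namespace Summit.HodgeConjecture.HodgeConjecture.Cruxes.HLiu418.K2LiuBigCellContinuationPointLetters

open Summit.HodgeConjecture.HodgeConjecture.Cruxes.HLiu418.K2LiuQRationalDefs

/-! ## §1 `q`-rational regularity at `s₀` ⟹ complex differentiability at `s₀` -/

/-- `s ↦ q^{−s}` is entire (`q ≠ 0`). [cite: Casselman1980, §3] -/
theorem differentiable_qVar {q : ℕ} (hq : q ≠ 0) : Differentiable ℂ fun s : ℂ => qVar q s := by
  unfold qVar
  exact Differentiable.const_cpow differentiable_neg (Or.inl (by exact_mod_cast hq))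

/-- `s ↦ P(q^{−s})` is entire. [cite: Casselman1980, §3] -/
theorem differentiable_eval_qVar {q : ℕ} (hq : q ≠ 0) (P : ℂ[X]) : Differentiable ℂ fun s : ℂ => P.eval (qVar q s) :=
  P.differentiable.comp (differentiable_qVar hq)

/-- the non-vanishing locus `{s | Q(q^{−s}) ≠ 0}` of an admissible denominator is open. [cite: Casselman1980, §3] -/
theorem isOpen_setOf_eval_qVar_ne_zero {q : ℕ} (hq : q ≠ 0) (Q : ℂ[X]) : IsOpen {s : ℂ | Q.eval (qVar q s) ≠ 0} :=
  isOpen_ne_fun (differentiable_eval_qVar hq Q).continuous continuous_const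

/-- **`q`-RATIONAL AND REGULAR AT `s₀` ⟹ DIFFERENTIABLE AT `s₀`.**  If `φ s = P(q^{−s})∕Q(q^{−s})` off the zeros of `Q(q^{−s})` and `Q(q^{−s₀}) ≠ 0`, then on the
open neighbourhood `{Q(q^{−s}) ≠ 0}` of `s₀` the function `φ` IS the holomorphic function `(P∕Q)(q^{−s})`, so `φ` is complex-differentiable at `s₀`.
[cite: KudlaSweet1997, §1] [cite: Casselman1980, §3 Thm. 3.1] -/
theorem differentiableAt_of_isQRationalRegularAt {q : ℕ} (hq : q ≠ 0) {s₀ : ℂ} {φ : ℂ → ℂ} (h : IsQRationalRegularAt q s₀ φ) :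
    DifferentiableAt ℂ φ s₀ := by
  obtain ⟨P, Q, hQ, hφ⟩ := h
  have hg : DifferentiableAt ℂ (fun s : ℂ => P.eval (qVar q s) / Q.eval (qVar q s)) s₀ :=
    ((differentiable_eval_qVar hq P) s₀).div ((differentiable_eval_qVar hq Q) s₀) hQ
  refine hg.congr_of_eventuallyEq ?_
  filter_upwards [(isOpen_setOf_eval_qVar_ne_zero hq Q).mem_nhds hQ] with s hs
  exact hφ s hs

/-- **THE BRIDGE A7-AllS0 → TOP**: pointwise `q`-rational regularity on a set `U` gives holomorphy on `U`:
`(∀ s₀ ∈ U, IsQRationalRegularAt q s₀ φ) → DifferentiableOn ℂ φ U`. [cite: KudlaSweet1997, §1] [cite: Tan1999, §3] -/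
theorem differentiableOn_of_forall_isQRationalRegularAt {q : ℕ} (hq : q ≠ 0) {U : Set ℂ} {φ : ℂ → ℂ}
    (h : ∀ s₀ ∈ U, IsQRationalRegularAt q s₀ φ) : DifferentiableOn ℂ φ U :=
  fun s₀ hs₀ => (differentiableAt_of_isQRationalRegularAt hq (h s₀ hs₀)).differentiableWithinAt

/-- the same on the right half-plane `{0 < re}` in A7-AllS0's bytes `∀ s₀, 0 < s₀.re → IsQRationalRegularAt q s₀ φ`. [cite: KudlaSweet1997, §1] [cite: Tan1999, §3] -/
theorem differentiableOn_re_pos_of_forall_isQRationalRegularAt {q : ℕ} (hq : q ≠ 0) {φ : ℂ → ℂ}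
    (h : ∀ s₀ : ℂ, 0 < s₀.re → IsQRationalRegularAt q s₀ φ) : DifferentiableOn ℂ φ {s : ℂ | 0 < s.re} :=
  differentiableOn_of_forall_isQRationalRegularAt hq fun s₀ hs₀ => h s₀ hs₀

/-! ## §2 The point assembly of the faces -/

/-- **THE BIG-CELL CONTINUATION AT A POINT FROM ITS FACES (hypothesis-first).**  Abstract finite index `TF` of bad finite places with residue characteristics
`q v ≠ 0`; archimedean block `A` and explicit local scalars `c v` holomorphic on `{0 < re}`; normalised local values `N v` `q_v`-rational regular at every `s₀` with
`0 < re s₀` (A7-AllS0 verbatim); and the EULER-FACE IDENTITY `B s = A s · ∏_{v∈TF} (c v s · N v s)` on the convergence half-plane `c₀ < re s` (BY VALUE).  Then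
`B` — e.g. `B s = a(s)·M(s)f_s(κ)` — continues holomorphically to `{0 < re}`. [cite: Tan1999, §3] [cite: KudlaSweet1997, §1] [cite: HarrisKudlaSweet1996, §6 (6.14)–(6.16)] -/
theorem exists_pointContinuation_of_faces {ι : Type*} (TF : Finset ι) (q : ι → ℕ) (hq : ∀ v ∈ TF, q v ≠ 0) (c₀ : ℝ)
    (A : ℂ → ℂ) (hA : DifferentiableOn ℂ A {s : ℂ | 0 < s.re})
    (c N : ι → ℂ → ℂ) (hc : ∀ v ∈ TF, DifferentiableOn ℂ (c v) {s : ℂ | 0 < s.re})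
    (hN : ∀ v ∈ TF, ∀ s₀ : ℂ, 0 < s₀.re → IsQRationalRegularAt (q v) s₀ (N v))
    (B : ℂ → ℂ) (hB : ∀ s : ℂ, c₀ < s.re → B s = A s * ∏ v ∈ TF, (c v s * N v s)) :
    ∃ Eκ : ℂ → ℂ, DifferentiableOn ℂ Eκ {s : ℂ | 0 < s.re} ∧ ∀ s : ℂ, c₀ < s.re → Eκ s = B s :=
  ⟨fun s => A s * ∏ v ∈ TF, (c v s * N v s),
    hA.mul (DifferentiableOn.fun_finsetProd fun v hv => (hc v hv).mul (differentiableOn_re_pos_of_forall_isQRationalRegularAt (hq v hv) (hN v hv))),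
    fun s hs => (hB s hs).symm⟩

/-- the same with the normalised local values already holomorphic on `{0 < re}` (e.g. after §1, or for a supplier in the TOP's currency).
[cite: Tan1999, §3] [cite: KudlaSweet1997, §1] -/
theorem exists_pointContinuation_of_faces' {ι : Type*} (TF : Finset ι) (c₀ : ℝ)
    (A : ℂ → ℂ) (hA : DifferentiableOn ℂ A {s : ℂ | 0 < s.re})
    (c N : ι → ℂ → ℂ) (hc : ∀ v ∈ TF, DifferentiableOn ℂ (c v) {s : ℂ | 0 < s.re}) (hN : ∀ v ∈ TF, DifferentiableOn ℂ (N v) {s : ℂ | 0 < s.re})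
    (B : ℂ → ℂ) (hB : ∀ s : ℂ, c₀ < s.re → B s = A s * ∏ v ∈ TF, (c v s * N v s)) :
    ∃ Eκ : ℂ → ℂ, DifferentiableOn ℂ Eκ {s : ℂ | 0 < s.re} ∧ ∀ s : ℂ, c₀ < s.re → Eκ s = B s :=
  ⟨fun s => A s * ∏ v ∈ TF, (c v s * N v s), hA.mul (DifferentiableOn.fun_finsetProd fun v hv => (hc v hv).mul (hN v hv)), fun s hs => (hB s hs).symm⟩

end Summit.HodgeConjecture.HodgeConjecture.Cruxes.HLiu418.K2LiuBigCellContinuationPointLetters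

end
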